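import Summits.Ventures.PercRepro.ProfilePointedCircuitClassesTwelveCaptureB

/-!
# PercRepro — THE `x`-SPLIT OF THE CAPTURE INEQUALITY (C) AT A SERIES PAIR: (C) ⟸ (L*) ∧ (B*) (p5, gen 50;
`proofs/P5-GM1.md` §75 ADDENDUM 3)

For a series pair `{a, a'}` of `N` (`#E = 12`, `ρ(E) = 7`) avoiding `e`, the twelve-point statement at `e` follows from
the capture inequality (C) (gen 45, `inCount_five_le_outCount_six_of_seriesPair_of_capture`):
`#{W ∈ BI_5 : e, a ∈ W, a' ∈ cl W} ≤ #{S ∈ BI_6 : e ∉ S, a ∈ S, a' ∈ cl S}`.  Fix a fourth point `x` (in the line regime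
`{e, a, a', x}` is a 4-circuit, i.e. `a'` lies on the line through `e` and `x` in `N ／ a`; the split below is pure
counting and needs no hypothesis on `x`).  Split the units by `x ∈ S` and, for `x ∉ S`, by `a' ∈ S`:
`#𝒰_cap = #{x ∈ S} + #{x ∉ S, a' ∈ S} + #{x ∉ S, a' ∉ S, a' ∈ cl S}` (a unit containing `a'` captures it trivially).
Then (C) follows from the two statements
* **(L*)** `#{W ∈ BI_5 : e, a ∈ W, a' ∈ cl W} ≤ #{S ∈ 𝒰_cap : x ∈ S} + #{S ∈ BI_6 : e ∉ S, a, a' ∈ S, x ∉ S} +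
  #{W ∈ BI_5 : e ∉ W, a ∈ W, x ∉ W, a' ∈ cl W}` — in the minor `N ／ a ∖ a'` with `f = a'`: the demands through `e`
  against the units through `x`, ALL bi-independent 4-sets avoiding `e` and `x`, and the 5-sets through `x` — a
  statement about the ten-point matroid and the two points `e, x` alone when `{e, a, a', x}` is a circuit;
* **(B*)** `#{W ∈ BI_5 : e ∉ W, a ∈ W, x ∉ W, a' ∈ cl W} ≤ #{S ∈ BI_6 : e ∉ S, a ∈ S, a' ∉ S, x ∉ S, a' ∈ cl S}` — the
  captured bi-independent 4-sets of the minor avoiding `e, x` against its captured 5-sets avoiding `e, x`.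
Both are census-true and survive the adversary (§75 ADD 3); neither is proved.  This module records the reduction:
`captureIneq_of_split` and `inCount_five_le_outCount_six_of_seriesPair_of_split`.
-/

open scoped Matroid

namespace PercRepro.Cogirth

open Finset ThmH Skew Shadow Profile

variable {α : Type} [DecidableEq α] {N : Matroid α} [N.Finite]

section TwelveCaptureSplit

/-- A bi-independent `6`-set containing `a'` satisfies `ρ(S + a') = 6`. -/
theorem rk_insert_eq_six_of_mem_of_mem_biIndepSets_six {a' : α} {S : Finset α} (hS : S ∈ biIndepSets N 6)
    (ha' : a' ∈ S) : rk N (insert a' S) = 6 := by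
  rw [mem_biIndepSets] at hS
  rw [insert_eq_of_mem ha', hS.2.2.1, hS.2.1]

/-- **THE `x`-SPLIT OF (C)**: the captured units split by `x ∈ S` and by `a' ∈ S`; (L*) and (B*) add up to (C). -/
theorem captureIneq_of_split {a a' e x : α}
    (hL : ((biIndepSets N 5).filter (fun W => (e ∈ W ∧ a ∈ W) ∧ rk N (insert a' W) = 5)).card ≤
      ((biIndepSets N 6).filter (fun S => ((e ∉ S ∧ a ∈ S) ∧ rk N (insert a' S) = 6) ∧ x ∈ S)).card +
      ((biIndepSets N 6).filter (fun S => (e ∉ S ∧ a ∈ S) ∧ a' ∈ S ∧ x ∉ S)).card +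
      ((biIndepSets N 5).filter (fun W => (e ∉ W ∧ a ∈ W) ∧ x ∉ W ∧ rk N (insert a' W) = 5)).card)
    (hB : ((biIndepSets N 5).filter (fun W => (e ∉ W ∧ a ∈ W) ∧ x ∉ W ∧ rk N (insert a' W) = 5)).card ≤
      ((biIndepSets N 6).filter (fun S => ((e ∉ S ∧ a ∈ S) ∧ a' ∉ S ∧ x ∉ S) ∧ rk N (insert a' S) = 6)).card) :
    ((biIndepSets N 5).filter (fun W => (e ∈ W ∧ a ∈ W) ∧ rk N (insert a' W) = 5)).card ≤
      ((biIndepSets N 6).filter (fun S => (e ∉ S ∧ a ∈ S) ∧ rk N (insert a' S) = 6)).card := by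
  -- the units split by `x ∈ S`
  have h1 := card_filter_add_card_filter_not
    (s := (biIndepSets N 6).filter (fun S => (e ∉ S ∧ a ∈ S) ∧ rk N (insert a' S) = 6)) (fun S => x ∈ S)
  rw [filter_filter, filter_filter] at h1
  -- the units avoiding `x` split by `a' ∈ S`
  have h2 := card_filter_add_card_filter_not
    (s := (biIndepSets N 6).filter (fun S => ((e ∉ S ∧ a ∈ S) ∧ rk N (insert a' S) = 6) ∧ ¬ x ∈ S))
    (fun S => a' ∈ S)
  rw [filter_filter, filter_filter] at h2
  -- identify the three pieces with the terms of (L*) and (B*)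
  have e1 : ((biIndepSets N 6).filter (fun S => (((e ∉ S ∧ a ∈ S) ∧ rk N (insert a' S) = 6) ∧ ¬ x ∈ S) ∧ a' ∈ S)) =
      (biIndepSets N 6).filter (fun S => (e ∉ S ∧ a ∈ S) ∧ a' ∈ S ∧ x ∉ S) := by
    apply filter_congr
    intro S hS
    constructor
    · rintro ⟨⟨⟨h, _⟩, hx⟩, ha'⟩
      exact ⟨h, ha', hx⟩
    · rintro ⟨h, ha', hx⟩
      exact ⟨⟨⟨h, rk_insert_eq_six_of_mem_of_mem_biIndepSets_six hS ha'⟩, hx⟩, ha'⟩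
  have e2 : ((biIndepSets N 6).filter (fun S => (((e ∉ S ∧ a ∈ S) ∧ rk N (insert a' S) = 6) ∧ ¬ x ∈ S) ∧ ¬ a' ∈ S)) =
      (biIndepSets N 6).filter (fun S => ((e ∉ S ∧ a ∈ S) ∧ a' ∉ S ∧ x ∉ S) ∧ rk N (insert a' S) = 6) := by
    apply filter_congr
    intro S _
    tauto
  rw [e1, e2] at h2
  omega

/-- **THE TWELVE-POINT STATEMENT AT A POINT AVOIDED BY A SERIES PAIR, MODULO (L*) AND (B*)** — the reduction of gen 45
composed with the `x`-split. -/
theorem inCount_five_le_outCount_six_of_seriesPair_of_split {a a' e x : α} (hn : (gr N).card = 12)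
    (hR : rk N (gr N) = 7) (h : SeriesPair N a a') (he : e ∈ gr N) (hea : e ≠ a) (hea' : e ≠ a')
    (hL : ((biIndepSets N 5).filter (fun W => (e ∈ W ∧ a ∈ W) ∧ rk N (insert a' W) = 5)).card ≤
      ((biIndepSets N 6).filter (fun S => ((e ∉ S ∧ a ∈ S) ∧ rk N (insert a' S) = 6) ∧ x ∈ S)).card +
      ((biIndepSets N 6).filter (fun S => (e ∉ S ∧ a ∈ S) ∧ a' ∈ S ∧ x ∉ S)).card +
      ((biIndepSets N 5).filter (fun W => (e ∉ W ∧ a ∈ W) ∧ x ∉ W ∧ rk N (insert a' W) = 5)).card)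
    (hB : ((biIndepSets N 5).filter (fun W => (e ∉ W ∧ a ∈ W) ∧ x ∉ W ∧ rk N (insert a' W) = 5)).card ≤
      ((biIndepSets N 6).filter (fun S => ((e ∉ S ∧ a ∈ S) ∧ a' ∉ S ∧ x ∉ S) ∧ rk N (insert a' S) = 6)).card) :
    inCount N 5 e ≤ outCount N 6 e :=
  inCount_five_le_outCount_six_of_seriesPair_of_capture hn hR h he hea hea' (captureIneq_of_split hL hB)

end TwelveCaptureSplit

end PercRepro.Cogirth
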